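import Literature.Topology.FourManifolds.NonSeparatingSpheresStandardLoop
import Literature.Topology.FourManifolds.NonSeparatingSpheresLoopHomotopy
import Literature.Topology.FourManifolds.NonSeparatingSpheresCover
import Literature.Topology.FourManifolds.CircleMapWinding
import Literature.Topology.FourManifolds.CircleDiffeotopyProofs
import Literature.Geometry.Manifold.SmoothEmbeddingInverse
import HarnessLib

/-!
# Budney–Gabai Thm. 3.13, `n = 1`: after a torus automorphism every embedded circle lifts

Fact seat of `Literature.Topology.FourManifolds.BudneyGabai2019_thm_3_13`
(`NonSeparatingSpheres.lean`; R. Budney, D. Gabai, *Knotted 3-balls in `S⁴`*, arXiv:1912.09029,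
Thm. 3.13), classical case `n = 1` (simple closed curves on the torus `S¹ × S¹`).  The argument
on the cyclic cover `ℝ × Sⁿ → S¹ × Sⁿ` (`NonSeparatingSpheresClassical.lean`) starts from a lift
of the sphere; for `n ≥ 2` every sphere lifts (`exists_lift_isSmoothEmbedding`), for `n = 1` a
curve `c = (c₁, c₂) : S¹ → S¹ × S¹` lifts iff its first coordinate `c₁ : S¹ → S¹` has degree
`0`.  This file supplies the classical normalisation by `SL₂(ℤ)` (D. Rolfsen, *Knots and Links*
(1976), §2.C: the linear automorphisms `(z, w) ↦ (zᵖ wᵠ, zʳ wˢ)`, `ps - qr = 1`, of the torus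
act on the bidegrees `(a, b)` of curves; Bezout): for every smooth `c` there is a diffeomorphism
`Φ₀` of `S¹ × S¹` such that `Φ₀ ∘ c` has first degree `p a + q b = 0` and hence lifts.

* `exists_diffeomorph_toCircle` — the identification `𝕊¹ ≃ Circle` of the round circle with
  Mathlib's circle group as a diffeomorphism (`isSmoothEmbedding_toCircle`, bijective);
* `exists_int_sl2_apply_eq_zero` — for `a, b ∈ ℤ` there is `(p q; r s) ∈ SL₂(ℤ)` with
  `p a + q b = 0`;
* `exists_contMDiff_lift_of_periodic` — a smooth `f : 𝕊¹ → S¹` whose composite with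
  `θ ↦ (cos θ, sin θ)` has a `2π`-periodic continuous lift through `exp` has a smooth lift
  `𝕊¹ → ℝ`;
* `isSmoothEmbedding_of_lift` — a smooth lift of a smooth embedding to the cyclic cover is a
  smooth embedding (all `n`; the argument of `exists_lift_isSmoothEmbedding`);
* `exists_diffeomorph_comp_lift` — **the normalisation**: for a smooth embedding
  `c : 𝕊¹ → S¹ × 𝕊¹` there are a diffeomorphism `Φ₀` of `S¹ × 𝕊¹` and a smooth embedding
  `c̃ : 𝕊¹ → ℝ × 𝕊¹` with `(exp × id) ∘ c̃ = Φ₀ ∘ c`.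

Everything here is proved; no definition and no named fact is introduced.

## References

* R. Budney, D. Gabai, *Knotted 3-balls in `S⁴`*, arXiv:1912.09029 (v2), §3, Thm. 3.13.
  [BudneyGabai2019]
* D. Rolfsen, *Knots and Links*, Publish or Perish (1976), §2.C (curves on the torus and
  `SL₂(ℤ)`). [Rolfsen1976]
* A. Hatcher, *Algebraic Topology*, CUP (2002), §1.1 Thm. 1.7, §1.3 Prop. 1.33 (lifting
  criterion). [HatcherAT2002]
-/

noncomputable section

open scoped Manifold ContDiff Topology Real unitInterval
open Set Function Metric

namespace Literature.Topology.FourManifolds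

namespace BudneyGabai2019_thm_3_13

open CircleMaps

local notation "𝔼 " k:arg => EuclideanSpace ℝ (Fin k)
local notation "𝕊 " k:arg => (Metric.sphere (0 : EuclideanSpace ℝ (Fin (k + 1))) 1)

/-! ### The identification `𝕊¹ ≃ Circle` -/

/-- **The round circle is diffeomorphic to the circle group**, by `toCircle (x₀, x₁) = x₀ + i x₁`
(a bijective smooth embedding, `isSmoothEmbedding_toCircle`; the inverse of a smooth embedding
is smooth on its range, `Literature.Geometry.Manifold.contMDiffOn_invFun_range`). [folklore] -/
theorem exists_diffeomorph_toCircle :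
    ∃ ψ : (𝕊 1) ≃ₘ⟮𝓡 1, 𝓡 1⟯ Circle, ∀ u, ψ u = toCircle u := by
  haveI : Nonempty (𝕊 1) := ⟨ptA⟩
  have hs : ContMDiffOn (𝓡 1) (𝓡 1) ∞ (invFun toCircle) (range toCircle) :=
    Literature.Geometry.Manifold.contMDiffOn_invFun_range isSmoothEmbedding_toCircle
  rw [toCircle_surjective.range_eq, contMDiffOn_univ] at hs
  exact ⟨⟨⟨toCircle, invFun toCircle, leftInverse_invFun toCircle_injective,
    rightInverse_invFun toCircle_surjective⟩, contMDiff_toCircle, hs⟩, fun u ↦ rfl⟩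

/-! ### Arithmetic: killing the first degree by `SL₂(ℤ)` -/

/-- **Bezout**: for `a, b ∈ ℤ` there is a matrix `(p q; r s) ∈ SL₂(ℤ)` whose first row kills
`(a, b)`: `p a + q b = 0` (if `a = 0` take the identity; otherwise `(a, b) = g (a', b')` with
`a', b'` coprime, `a' u + b' v = 1`, and `(p, q, r, s) = (b', -a', u, v)`). [folklore] -/
theorem exists_int_sl2_apply_eq_zero (a b : ℤ) :
    ∃ p q r s : ℤ, p * s - q * r = 1 ∧ p * a + q * b = 0 := by
  by_cases ha : a = 0
  · exact ⟨1, 0, 0, 1, by ring, by rw [ha]; ring⟩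
  · have hg : 0 < Int.gcd a b := Int.gcd_pos_iff.2 (Or.inl ha)
    obtain ⟨g, a', b', -, hcop, hga, hgb⟩ := Int.exists_gcd_one' hg
    have hbez : (1 : ℤ) = a' * Int.gcdA a' b' + b' * Int.gcdB a' b' := by
      have := Int.gcd_eq_gcd_ab a' b'
      rwa [hcop, Nat.cast_one] at this
    refine ⟨b', -a', Int.gcdA a' b', Int.gcdB a' b', by linear_combination -hbez, ?_⟩
    rw [hga, hgb]; ring

/-- Exponent bookkeeping in a commutative group:
`(z^α w^β)^μ (z^γ w^δ)^ν = z^(αμ + γν) w^(βμ + δν)`. [folklore] -/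
theorem zpow_mul_zpow_combo {G : Type*} [CommGroup G] (z w : G) (α β γ δ μ ν : ℤ) :
    (z ^ α * w ^ β) ^ μ * (z ^ γ * w ^ δ) ^ ν = z ^ (α * μ + γ * ν) * w ^ (β * μ + δ * ν) := by
  rw [mul_zpow, mul_zpow, ← zpow_mul, ← zpow_mul, ← zpow_mul, ← zpow_mul, mul_mul_mul_comm,
    ← zpow_add, ← zpow_add]

/-! ### Lifting circle-valued maps of degree zero -/

/-- **A smooth circle-valued map on `𝕊¹` with a periodic lift has a smooth real lift.**  If
`f : 𝕊¹ → S¹` is `C^∞` and `K : ℝ → ℝ` is a continuous, `2π`-periodic lift of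
`θ ↦ f (cos θ, sin θ)` through `exp : ℝ → S¹`, then `f = exp ∘ G` for a `C^∞` function
`G : 𝕊¹ → ℝ` (`G = K ∘ (angle)`, locally `K ∘ L` for a smooth angle function `L`; `K` is smooth
by `CircleExpLift.contMDiff_of_continuous`). [cite: HatcherAT2002, Prop. 1.33] -/
theorem exists_contMDiff_lift_of_periodic {f : (𝕊 1) → Circle}
    (hf : ContMDiff (𝓡 1) (𝓡 1) ∞ f) {K : ℝ → ℝ} (hK : Continuous K)
    (hlift : ∀ θ, Circle.exp (K θ) = f (circlePoint θ)) (hper : ∀ θ, K (θ + 2 * π) = K θ) :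
    ∃ G : (𝕊 1) → ℝ, ContMDiff (𝓡 1) 𝓘(ℝ, ℝ) ∞ G ∧ ∀ u, Circle.exp (G u) = f u := by
  have hKs : ContMDiff 𝓘(ℝ, ℝ) 𝓘(ℝ, ℝ) ∞ K := by
    refine CircleExpLift.contMDiff_of_continuous hK ?_
    have : (fun θ ↦ Circle.exp (K θ)) = f ∘ circlePoint := funext hlift
    rw [this]
    exact hf.comp contMDiff_circlePoint
  have hperiodic : Periodic K (2 * π) := hper
  have hKeq : ∀ {s t : ℝ}, circlePoint s = circlePoint t → K s = K t := fun {s t} h ↦ by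
    obtain ⟨k, hk⟩ := exists_eq_add_of_circlePoint_eq h
    rw [hk]
    exact hperiodic.int_mul k t
  refine ⟨fun u ↦ K (2 * π * angA u), fun u₀ ↦ ?_, fun u ↦ ?_⟩
  · obtain ⟨L, hL, hLcp⟩ := exists_angle_contMDiffAt u₀
    have heq : (fun u ↦ K (2 * π * angA u)) = K ∘ L := funext fun u ↦
      hKeq (by rw [circlePoint_two_pi_mul_angA, hLcp])
    rw [heq]
    exact hKs.contMDiffAt.comp u₀ hL
  · rw [hlift, circlePoint_two_pi_mul_angA]

/-! ### Lifts of embeddings are embeddings -/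

/-- **A smooth lift of a smoothly embedded sphere to the cyclic cover is a smooth embedding**
(all `n`): it is injective because the embedding is, its differential is injective because
`d(exp × id) ∘ d ẽ = d e` is (`mfderiv_injective_of_isImmersion`), and an injective immersion of
the compact `Sⁿ` is an embedding (`isSmoothEmbedding_of_injective_of_injective_mfderiv`, Hirsch,
*Differential Topology*, Ch. 1 §3, Thm. 3.1). [folklore] -/
theorem isSmoothEmbedding_of_lift {n : ℕ} {e : (𝕊 n) → Circle × 𝕊 n}
    (he : Manifold.IsSmoothEmbedding (𝓡 n) ((𝓡 1).prod (𝓡 n)) ∞ e)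
    {el : (𝕊 n) → ℝ × 𝕊 n} (hel : ContMDiff (𝓡 n) (𝓘(ℝ, ℝ).prod (𝓡 n)) ∞ el)
    (hlift : Prod.map Circle.exp id ∘ el = e) :
    Manifold.IsSmoothEmbedding (𝓡 n) (𝓘(ℝ, ℝ).prod (𝓡 n)) ∞ el := by
  have hinj : Injective e := he.isEmbedding.injective
  refine isSmoothEmbedding_of_injective_of_injective_mfderiv hel (by simp) ?_ fun x ↦ ?_
  · intro x y hxy
    exact hinj (by rw [← hlift, comp_apply, comp_apply, hxy])
  · have hde : Injective (mfderiv (𝓡 n) ((𝓡 1).prod (𝓡 n)) e x) :=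
      mfderiv_injective_of_isImmersion he.isImmersion (by simp) x
    rw [← hlift, mfderiv_comp x (contMDiff_prodMap_circleExp.mdifferentiableAt (by simp))
      (hel.mdifferentiableAt (by simp))] at hde
    have key : Injective
        (⇑(mfderiv (𝓘(ℝ, ℝ).prod (𝓡 n)) ((𝓡 1).prod (𝓡 n))
            (Prod.map Circle.exp id : ℝ × 𝕊 n → Circle × 𝕊 n) (el x)) ∘
          ⇑(mfderiv (𝓡 n) (𝓘(ℝ, ℝ).prod (𝓡 n)) el x)) := hde
    exact key.of_comp

/-! ### The normalisation -/

/-- **`SL₂(ℤ)`-normalisation of an embedded circle in the torus.**  For every smooth embedding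
`c : 𝕊¹ → S¹ × 𝕊¹` there are a diffeomorphism `Φ₀` of `S¹ × 𝕊¹` and a smooth embedding
`c̃ : 𝕊¹ → ℝ × 𝕊¹` with `(exp × id) ∘ c̃ = Φ₀ ∘ c`.  Proof (Rolfsen 1976, §2.C): identify
`𝕊¹ ≃ Circle` (`exists_diffeomorph_toCircle`); let `a`, `b` be the winding numbers of the two
coordinates of `c` along the standard loop; choose `(p q; r s) ∈ SL₂(ℤ)` with `p a + q b = 0`
(`exists_int_sl2_apply_eq_zero`) and let `Φ₀` be the linear automorphism
`(z, w) ↦ (zᵖ wᵠ, zʳ wˢ)` read on `S¹ × 𝕊¹`; the first coordinate of `Φ₀ ∘ c` has winding number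
`p a + q b = 0` (`CircleMaps.winding_mul`, `winding_zpow`), so its lift along `ℝ → 𝕊¹ → S¹` is
`2π`-periodic (`exists_int_apply_add_two_pi`) and descends to a smooth lift
(`exists_contMDiff_lift_of_periodic`); the lifted curve is an embedding by
`isSmoothEmbedding_of_lift`. [cite: Rolfsen1976, §2.C] [cite: HatcherAT2002, §1.1 Thm. 1.7] -/
theorem exists_diffeomorph_comp_lift {c : (𝕊 1) → Circle × 𝕊 1}
    (hc : Manifold.IsSmoothEmbedding (𝓡 1) ((𝓡 1).prod (𝓡 1)) ∞ c) :
    ∃ (Φ₀ : (Circle × 𝕊 1) ≃ₘ⟮(𝓡 1).prod (𝓡 1), (𝓡 1).prod (𝓡 1)⟯ (Circle × 𝕊 1))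
      (cl : (𝕊 1) → ℝ × 𝕊 1),
      Manifold.IsSmoothEmbedding (𝓡 1) (𝓘(ℝ, ℝ).prod (𝓡 1)) ∞ cl ∧
        Prod.map Circle.exp id ∘ cl = Φ₀ ∘ c := by
  have hπ : (0 : ℝ) < 2 * π := by positivity
  obtain ⟨ψ, hψ⟩ := exists_diffeomorph_toCircle
  have hψcp : ∀ θ, ψ (circlePoint θ) = Circle.exp θ := fun θ ↦ by
    rw [hψ, toCircle_circlePoint]
  have hψ'exp : ∀ θ, ψ.symm (Circle.exp θ) = circlePoint θ := fun θ ↦ by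
    rw [← hψcp, ψ.symm_apply_apply]
  have hcs : ContMDiff (𝓡 1) ((𝓡 1).prod (𝓡 1)) ∞ c := hc.contMDiff
  have hc₁ : ContMDiff (𝓡 1) (𝓡 1) ∞ fun y ↦ (c y).1 := contMDiff_fst.comp hcs
  have hc₂ : ContMDiff (𝓡 1) (𝓡 1) ∞ fun y ↦ ψ (c y).2 :=
    ψ.contMDiff.comp (contMDiff_snd.comp hcs)
  -- the two coordinate maps and their winding numbers along the standard loop
  set E₁ : C(𝕊 1, Circle) := ⟨fun y ↦ (c y).1, hc₁.continuous⟩ with hE₁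
  set E₂ : C(𝕊 1, Circle) := ⟨fun y ↦ ψ (c y).2, hc₂.continuous⟩ with hE₂
  set γ₀ : Path (ψ.symm 1) (ψ.symm 1) := stdLoop.map ψ.symm.continuous with hγ₀
  have hγ₀t : ∀ t : I, γ₀ t = circlePoint (2 * π * t) := fun t ↦ by
    rw [hγ₀, Path.map_coe, comp_apply, stdLoop_apply, hψ'exp]
  obtain ⟨p, q, r, s, hdet, hpq⟩ := exists_int_sl2_apply_eq_zero (winding E₁ γ₀) (winding E₂ γ₀)
  -- ### the torus automorphism `Φ₀ (z, u) = (zᵖ ψ(u)ᵠ, ψ⁻¹ (zʳ ψ(u)ˢ))` and its inverse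
  have hsm : ∀ (i j : ℤ), ContMDiff ((𝓡 1).prod (𝓡 1)) (𝓡 1) ∞
      fun x : Circle × 𝕊 1 ↦ x.1 ^ i * ψ x.2 ^ j := fun i j ↦
    ((contMDiff_circle_zpow i).comp contMDiff_fst).mul
      ((contMDiff_circle_zpow j).comp (ψ.contMDiff.comp contMDiff_snd))
  have hz1 : ∀ z w : Circle, (z ^ p * w ^ q) ^ s * (z ^ r * w ^ s) ^ (-q) = z := fun z w ↦ by
    rw [zpow_mul_zpow_combo, show p * s + r * -q = 1 by linear_combination hdet,
      show q * s + s * -q = 0 by ring, zpow_one, zpow_zero, mul_one]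
  have hz2 : ∀ z w : Circle, (z ^ p * w ^ q) ^ (-r) * (z ^ r * w ^ s) ^ p = w := fun z w ↦ by
    rw [zpow_mul_zpow_combo, show p * -r + r * p = 0 by ring,
      show q * -r + s * p = 1 by linear_combination hdet, zpow_one, zpow_zero, one_mul]
  have hz3 : ∀ z w : Circle, (z ^ s * w ^ (-q)) ^ p * (z ^ (-r) * w ^ p) ^ q = z := fun z w ↦ by
    rw [zpow_mul_zpow_combo, show s * p + -r * q = 1 by linear_combination hdet,
      show -q * p + p * q = 0 by ring, zpow_one, zpow_zero, mul_one]
  have hz4 : ∀ z w : Circle, (z ^ s * w ^ (-q)) ^ r * (z ^ (-r) * w ^ p) ^ s = w := fun z w ↦ by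
    rw [zpow_mul_zpow_combo, show s * r + -r * s = 0 by ring,
      show -q * r + p * s = 1 by linear_combination hdet, zpow_one, zpow_zero, one_mul]
  set Φ₀ : (Circle × 𝕊 1) ≃ₘ⟮(𝓡 1).prod (𝓡 1), (𝓡 1).prod (𝓡 1)⟯ (Circle × 𝕊 1) :=
    ⟨⟨fun x ↦ (x.1 ^ p * ψ x.2 ^ q, ψ.symm (x.1 ^ r * ψ x.2 ^ s)),
      fun x ↦ (x.1 ^ s * ψ x.2 ^ (-q), ψ.symm (x.1 ^ (-r) * ψ x.2 ^ p)),
      fun x ↦ by simp only [ψ.apply_symm_apply, hz1, hz2, ψ.symm_apply_apply],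
      fun x ↦ by simp only [ψ.apply_symm_apply, hz3, hz4, ψ.symm_apply_apply]⟩,
      (hsm p q).prodMk (ψ.symm.contMDiff.comp (hsm r s)),
      (hsm s (-q)).prodMk (ψ.symm.contMDiff.comp (hsm (-r) p))⟩ with hΦ₀
  have hΦ₀fst : ∀ y, (Φ₀ (c y)).1 = (E₁ ^ p * E₂ ^ q) y := fun y ↦ by
    simp only [hΦ₀, hE₁, hE₂, ContinuousMap.mul_apply, ContinuousMap.zpow_apply,
      ContinuousMap.coe_mk]
    rfl
  -- ### the first coordinate of `Φ₀ ∘ c` has winding number zero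
  set F : C(𝕊 1, Circle) := E₁ ^ p * E₂ ^ q with hF
  have hF0 : winding F γ₀ = 0 := by
    rw [hF, winding_mul, winding_zpow, winding_zpow, hpq]
  have hFs : ContMDiff (𝓡 1) (𝓡 1) ∞ F := by
    have : (F : (𝕊 1) → Circle) = fun y ↦ (Φ₀ (c y)).1 := funext fun y ↦ (hΦ₀fst y).symm
    rw [this]
    exact contMDiff_fst.comp (Φ₀.contMDiff.comp hcs)
  -- ### its lift along `ℝ → 𝕊¹` is `2π`-periodic
  obtain ⟨K, hK⟩ := CircleExpLift.exists_continuousMap_comp_eq (X := ℝ)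
    ⟨F ∘ circlePoint, F.continuous.comp continuous_circlePoint⟩
  have hK' : ∀ θ, Circle.exp (K θ) = F (circlePoint θ) := hK
  obtain ⟨d, hd⟩ := exists_int_apply_add_two_pi (φ := ψ.symm ∘ F) (Φ := K) K.continuous
    (fun θ ↦ by rw [← hψ'exp, hK', comp_apply])
  have hincr : incr F γ₀ = K (2 * π) - K 0 := by
    have h := incr_eq_of_lift F γ₀ (G := fun t : I ↦ K (2 * π * t))
      (K.continuous.comp (continuous_const.mul continuous_subtype_val))
      (fun t ↦ by rw [hK', hγ₀t])
    simpa using h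
  have hd0 : d = 0 := by
    have h1 : incr F γ₀ = 0 := by rw [incr_eq_winding, hF0]; simp
    have h2 := hd 0
    rw [zero_add] at h2
    have h3 : (d : ℝ) * (2 * π) = 0 := by linarith
    exact_mod_cast (mul_eq_zero.1 h3).resolve_right hπ.ne'
  have hper : ∀ θ, K (θ + 2 * π) = K θ := fun θ ↦ by
    rw [hd θ, hd0, Int.cast_zero, zero_mul, add_zero]
  -- ### the smooth lift and the lifted curve
  obtain ⟨G, hGs, hG⟩ := exists_contMDiff_lift_of_periodic hFs K.continuous hK' hper
  have hlift : Prod.map Circle.exp id ∘ (fun y ↦ ((G y, (Φ₀ (c y)).2) : ℝ × 𝕊 1)) = Φ₀ ∘ c := by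
    funext y
    refine Prod.ext ?_ rfl
    simp only [comp_apply, Prod.map_fst]
    rw [hG, hΦ₀fst]
  refine ⟨Φ₀, fun y ↦ (G y, (Φ₀ (c y)).2), isSmoothEmbedding_of_lift (hc.diffeomorph_comp Φ₀)
    (hGs.prodMk (contMDiff_snd.comp (Φ₀.contMDiff.comp hcs))) hlift, hlift⟩

end BudneyGabai2019_thm_3_13

end Literature.Topology.FourManifolds

end
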